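import Summits.BirchSwinnertonDyer.BirchSwinnertonDyer.Theorems.UniversalToricDescentRoadFFRationalDescent
import Summits.BirchSwinnertonDyer.BirchSwinnertonDyer.Theorems.ErratumRoadFiveBoundedCongruenceLimitEndForm
import HarnessLib

/-!
# Route `UniversalToricDescent`, crux ♭B_T `TwinWanFrameAtThreeMultT` (stmt-BirchSwinnertonDyer-27172; registries 26062 / 20694),
# line `membertower` v6, research stub `stub_wanFrameMultCube` — cube-locus port step (P3): LEAD g11's RATIONAL one-sided
# congruence descent (p612782) WITH A BOUNDED DEFECT in place of the member congruence isomorphism `e_m` — the common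
# quotient `Q_m` of `(R′⊗X)/p^m` and `N_m/p^m` whose `N_m`-side kernel is generated by `n` elements and killed by `d`
# (THEOREM T♭'s control defect; bsd-stepL `BoundedCongruenceLimit.defect_le_sup_of_boundedKernel`); the exponent `d^n` joins `a`

Cell `bsd-wall` (run/shared/lean/pub/bsd-wall/), width seat `bsd-wall-utd-p2-w2` (prover g3, 2026-08-28);
`--supports stmt-BirchSwinnertonDyer-20694 --as helper`; Theses-free, PURE ALGEBRA (memo CUBE-LOCUS-PORT-MAP-w2g3 §2 (P3)).

## What and why

On the cube locus the member congruence is not an isomorphism `(R′_m ⊗_Λ X^Σ)/p^m ≃ N_m/p^m` but a CORRESPONDENCE through the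
common dual residual Selmer group `Q_m = Sel(M[p^m])^∨`: `(R′_m ⊗ X^Σ)/p^m ↠ Q_m` (dual of `Sel(M_E[p^m]) ↪ Sel(M_E)[p^m]`) and
`Kd_m → N_m/p^m ↠ Q_m → 0` exact (dual of Lemma 2.1 with defect for the member, `ErratumRoadFiveSelmerControlDefect` /
`…PontryaginDefect`), with `Kd_m` generated by `n` elements and killed by `d = p^k`, `n, k` INDEPENDENT of `m` (T♭'s (L1) bound,
`UniversalToricDescentTwinCubeLocalInvariants` at the twin). This file threads that defect through g11's twisted descent:

* §1 `CongruenceDescent.map_span_mul_fittingIdeal_le_sup_of_congruence_descent_le_defect` — ONE congruence step: member inclusion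
  `(a·Fitt_{R′}(N))·S′ ⊆ (L_m)`, (c) `(L_m) ⊆ (L) + I^m S′`, and the defect correspondence ⟹ `((a·d^n)·Fitt_R(M))·S ⊆ (L) + I^m S`
  (g11's step with `Fitt₀(R′⊗M) ⊆ Fitt₀(N) + I^m` replaced by `d^n·Fitt₀(R′⊗M) ⊆ d^n·Fitt₀(Q) ⊆ Fitt₀(N) + I^m`, Stacks 07ZA (3)+(4));
  `…_descent_le_of_le_span_mul_defect` — the Krull limit over all `m`: `J ⊆ (a·d^n)·Fitt_R(M) ⟹ J·S ⊆ (L)`.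
* §2 `AcSelmer.XAc.map_span_mul_fittingIdeal_le_span_of_oneSided_congruences_descent_le_printed_defect` — ON `X^Σ = X_ac^Σ(E[p^∞])`
  with members in the PRINTED rational shape «`N_m` torsion → `(a·Ch(N_m))·S′_m ⊆ (L_m)`»: `((a·d^n)·Fitt₀(X^Σ))·R₀⟦T⟧ ⊆ (L^Σ)`.
  With `a = C(p)^e`, `d = C(p)^k` this is g11's key with `e ↦ e + kn`, and g11's UNCHANGED twisted recombination
  `AcSelmer.XAc.forall_C_pow_mul_mem_span_of_map_span_mul_fittingIdeal_le` turns it into ♭B_T's `∃ k`-clause —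
  `AcSelmer.XAc.forall_C_pow_mul_mem_span_of_defect_congruences` (§3).

So after (P2) (the Selmer-level wiring producing `βM`, `ι`, `βN` per `m` from T♭'s kernel on the RoadFFMember objects), the cube
stub follows from the SAME rational member tower as the (dec) branch. HONEST FRAMING: theorems only (no definition, no named fact,
no `sorry`); unconditional algebra; closes nothing; BSD is not proved by any of this.

References: [StacksProject] Tag 07ZA (2)(3)(4), Tag 05GI; [Castella2018Erratum] Lemma 2.1, proof of Thm. 1.1 (p. 4); [Skinner2016PacificMC] §3.1.
-/

set_option autoImplicit false
set_option linter.dupNamespace false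

noncomputable section

open scoped Classical TensorProduct

open PowerSeries Literature.NumberTheory.EllipticCurves Literature.NumberTheory.EllipticCurves.Module
  Literature.RingTheory.FittingIdeal NumberField IsDedekindDomain Field
open Summit.BirchSwinnertonDyer.Rank1Residual.X11b.AcSelmer Summit.BirchSwinnertonDyer.Rank1Residual.X11b.Halves
  Summit.BirchSwinnertonDyer.Rank1Residual.X2
  Summit.BirchSwinnertonDyer.BirchSwinnertonDyer.Theorems.BoundedCongruenceLimit

namespace Summit.BirchSwinnertonDyer.Rank1Residual.X11b

/-! ### §1 The one-sided congruence step and limit, twisted by `a`, with a bounded defect -/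

namespace CongruenceDescent

universe u v w

variable {R : Type*} [CommRing R] {S : Type u} [CommRing S] (φ : R →+* S) (I : Ideal R)
  {M : Type*} [AddCommGroup M] [Module R M] [Module.Finite R M]

/-- **One congruence step, (c) ONE-SIDED, member inclusion twisted by `a`, congruence WITH BOUNDED DEFECT.** Square
`R → R′ →(φ′) S′ ← S` with `S′` faithfully flat over `S`; instead of `(R′ ⊗_R M)/I^m ≅ N/I^m`: a finite `R′`-module `Q` with
`βM : (R′ ⊗_R M)/I^m ↠ Q` and `Kd →ι N/I^m →βN Q → 0` exact, `Kd` generated by `n` elements and killed by `d ∈ R`; member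
inclusion `(a·Fitt_{R′}(N))·S′ ⊆ (L_m)`; `(L_m) ⊆ (L) + I^m S′`. THEN `((a·d^n)·Fitt_R(M))·S ⊆ (L) + I^m S`. g11's
`…_descent_le` (p612782) with Stacks 07ZA (3) along `βM` and (4)+(2) along `ι, βN` (bsd-stepL `defect_le_sup_of_boundedKernel`).
[cite: StacksProject, Tag 07ZA (2), (3), (4)] [cite: Castella2018Erratum, proof of Thm. 1.1 (p. 4), read one-sidedly] -/
theorem map_span_mul_fittingIdeal_le_sup_of_congruence_descent_le_defect (a d : R) (n : ℕ)
    (R' : Type v) [CommRing R'] [Algebra R R'] (S' : Type w) [CommRing S'] [Algebra S S']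
    [Module.FaithfullyFlat S S'] (φ' : R' →+* S')
    (hφ' : φ'.comp (algebraMap R R') = (algebraMap S S').comp φ)
    (N : Type*) [AddCommGroup N] [Module R' N] [Module.Finite R' N] {L : S} {Lm : S'} {m : ℕ}
    {Q : Type*} [AddCommGroup Q] [Module R' Q] [Module.Finite R' Q] {Kd : Type*} [AddCommGroup Kd] [Module R' Kd]
    (βM : ((R' ⊗[R] M) ⧸ ((I.map (algebraMap R R')) ^ m • (⊤ : Submodule R' (R' ⊗[R] M)))) →ₗ[R'] Q)
    (hβM : Function.Surjective βM)
    (ι : Kd →ₗ[R'] (N ⧸ ((I.map (algebraMap R R')) ^ m • (⊤ : Submodule R' N))))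
    (βN : (N ⧸ ((I.map (algebraMap R R')) ^ m • (⊤ : Submodule R' N))) →ₗ[R'] Q)
    (hex : Function.Exact ι βN) (hβN : Function.Surjective βN)
    (hgen : ∃ g : Fin n → Kd, Submodule.span R' (Set.range g) = ⊤)
    (hd : algebraMap R R' d ∈ Module.annihilator R' Kd)
    (hF : (Ideal.span {algebraMap R R' a} * Module.fittingIdeal R' N 0).map φ' ≤ Ideal.span {Lm})
    (hc : Ideal.span {Lm} ≤
      Ideal.span {algebraMap S S' L} ⊔ ((I.map φ).map (algebraMap S S')) ^ m) :
    (Ideal.span {a * d ^ n} * Module.fittingIdeal R M 0).map φ ≤ Ideal.span {L} ⊔ (I.map φ) ^ m := by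
  -- adapted from p612782 `map_span_mul_fittingIdeal_le_sup_of_congruence_descent_le` (LEAD utd-p2 g11); the change is `h0`
  set ψ : S →+* S' := algebraMap S S' with hψ
  have hcomp : ψ.comp φ = φ'.comp (algebraMap R R') := by rw [hψ, hφ']
  have had : (Ideal.span {a * d ^ n}).map (algebraMap R R') =
      Ideal.span {algebraMap R R' a} * Ideal.span {algebraMap R R' d ^ n} := by
    rw [Ideal.map_span, Set.image_singleton, map_mul, map_pow, Ideal.span_singleton_mul_span_singleton]
  have hA : ((Ideal.span {a * d ^ n} * Module.fittingIdeal R M 0).map φ).map ψ =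
      (Ideal.span {algebraMap R R' a} * Ideal.span {algebraMap R R' d ^ n} *
        Module.fittingIdeal R' (R' ⊗[R] M) 0).map φ' := by
    rw [Ideal.map_map, hcomp, ← Ideal.map_map, Ideal.map_mul, had, Module.fittingIdeal_baseChange]
  have hB : ((I.map φ) ^ m).map ψ = ((I.map (algebraMap R R')) ^ m).map φ' := by
    rw [Ideal.map_pow, Ideal.map_pow, Ideal.map_map, Ideal.map_map, hcomp]
  have hB' : ((I.map φ).map ψ) ^ m = ((I.map (algebraMap R R')) ^ m).map φ' := by
    rw [← Ideal.map_pow, hB]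
  have hC : (Ideal.span {L}).map ψ = Ideal.span {ψ L} := by
    rw [Ideal.map_span, Set.image_singleton]
  -- THE DEFECT STEP: `d^n · Fitt₀(R′ ⊗ M) ⊆ d^n · Fitt₀(Q) ⊆ Fitt₀(N) + I′^m`
  have h0 : Ideal.span {algebraMap R R' d ^ n} * Module.fittingIdeal R' (R' ⊗[R] M) 0 ≤
      Module.fittingIdeal R' N 0 ⊔ (I.map (algebraMap R R')) ^ m := by
    have hq : Module.fittingIdeal R' (R' ⊗[R] M) 0 ≤ Module.fittingIdeal R' Q 0 :=
      (Module.fittingIdeal_le_of_surjective (((I.map (algebraMap R R')) ^ m • (⊤ : Submodule R' (R' ⊗[R] M))).mkQ)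
        (Submodule.mkQ_surjective _) 0).trans (Module.fittingIdeal_le_of_surjective βM hβM 0)
    exact (Ideal.mul_mono_right hq).trans (defect_le_sup_of_boundedKernel (I.map (algebraMap R R')) m ι βN hex hβN hgen hd)
  -- the twisted one-sided congruence step over `R'`, pushed to `S'`
  have hstep : (Ideal.span {algebraMap R R' a} * Ideal.span {algebraMap R R' d ^ n} *
      Module.fittingIdeal R' (R' ⊗[R] M) 0).map φ' ≤ Ideal.span {Lm} ⊔ ((I.map (algebraMap R R')) ^ m).map φ' := by
    have h1 : Ideal.span {algebraMap R R' a} * Ideal.span {algebraMap R R' d ^ n} *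
        Module.fittingIdeal R' (R' ⊗[R] M) 0 ≤
        Ideal.span {algebraMap R R' a} * Module.fittingIdeal R' N 0 ⊔ (I.map (algebraMap R R')) ^ m := by
      rw [mul_assoc]
      exact (Ideal.mul_mono_right h0).trans (by
        rw [Ideal.mul_sup]
        exact sup_le_sup_left Ideal.mul_le_left _)
    refine (Ideal.map_mono h1).trans ?_
    rw [Ideal.map_sup]
    exact sup_le_sup_right hF _
  have himg : ((Ideal.span {a * d ^ n} * Module.fittingIdeal R M 0).map φ).map ψ ≤
      (Ideal.span {L} ⊔ (I.map φ) ^ m).map ψ := by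
    rw [Ideal.map_sup, hA, hB, hC]
    refine hstep.trans (sup_le ?_ le_sup_right)
    rw [← hB']
    exact hc
  have h := Ideal.comap_mono (f := ψ) himg
  rwa [hψ, Ideal.comap_map_eq_self_of_faithfullyFlat,
    Ideal.comap_map_eq_self_of_faithfullyFlat] at h

/-- **The one-sided congruence limit with bounded defect, twisted** — `S` Noetherian with `φ(I) ⊆ Jac(S)`; `J ⊆ (a·d^n)·Fitt_R(M)`;
for every `m ≥ 1` a coefficient square with `S′_m` faithfully flat, finite `R′_m`-modules `N_m`, `Q_m`, a module `Kd_m` generated by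
`n` elements and killed by `d`, the defect correspondence `(R′_m ⊗ M)/I^m ↠ Q_m ↞ N_m/I^m ← Kd_m` (exact, onto), the twisted member
inclusion and `(L_m) ⊆ (L) + I^m S′_m`. Then `J·S ⊆ ⋂_m ((L) + I^m S) = (L)` (Krull). `n`, `d` UNIFORM in `m` is the point.
[cite: Skinner2016PacificMC, §3.1 (p. 192)] [cite: StacksProject, Tag 05GI] -/
theorem map_le_span_of_oneSided_congruences_descent_le_of_le_span_mul_defect [IsNoetherianRing S]
    (hI : I.map φ ≤ (⊥ : Ideal S).jacobson) (a d : R) (n : ℕ) {J : Ideal R}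
    (hJ : J ≤ Ideal.span {a * d ^ n} * Module.fittingIdeal R M 0)
    (L : S) (R' : ℕ → Type v) [∀ m, CommRing (R' m)] [∀ m, Algebra R (R' m)]
    (S' : ℕ → Type w) [∀ m, CommRing (S' m)] [∀ m, Algebra S (S' m)]
    [∀ m, Module.FaithfullyFlat S (S' m)] (φ' : ∀ m, R' m →+* S' m)
    (hφ' : ∀ m, (φ' m).comp (algebraMap R (R' m)) = (algebraMap S (S' m)).comp φ)
    (N : ℕ → Type*) [∀ m, AddCommGroup (N m)] [∀ m, Module (R' m) (N m)]
    [∀ m, Module.Finite (R' m) (N m)]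
    (Q : ℕ → Type*) [∀ m, AddCommGroup (Q m)] [∀ m, Module (R' m) (Q m)] [∀ m, Module.Finite (R' m) (Q m)]
    (Kd : ℕ → Type*) [∀ m, AddCommGroup (Kd m)] [∀ m, Module (R' m) (Kd m)]
    (Lm : ∀ m, S' m)
    (βM : ∀ m, (((R' m ⊗[R] M) ⧸ ((I.map (algebraMap R (R' m))) ^ m •
        (⊤ : Submodule (R' m) (R' m ⊗[R] M)))) →ₗ[R' m] Q m))
    (hβM : ∀ m, 1 ≤ m → Function.Surjective (βM m))
    (ι : ∀ m, Kd m →ₗ[R' m] (N m ⧸ ((I.map (algebraMap R (R' m))) ^ m • (⊤ : Submodule (R' m) (N m)))))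
    (βN : ∀ m, (N m ⧸ ((I.map (algebraMap R (R' m))) ^ m • (⊤ : Submodule (R' m) (N m)))) →ₗ[R' m] Q m)
    (hex : ∀ m, 1 ≤ m → Function.Exact (ι m) (βN m)) (hβN : ∀ m, 1 ≤ m → Function.Surjective (βN m))
    (hgen : ∀ m, 1 ≤ m → ∃ g : Fin n → Kd m, Submodule.span (R' m) (Set.range g) = ⊤)
    (hd : ∀ m, 1 ≤ m → algebraMap R (R' m) d ∈ Module.annihilator (R' m) (Kd m))
    (hF : ∀ m : ℕ, 1 ≤ m →
      (Ideal.span {algebraMap R (R' m) a} * Module.fittingIdeal (R' m) (N m) 0).map (φ' m) ≤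
        Ideal.span {Lm m})
    (hc : ∀ m : ℕ, 1 ≤ m →
      Ideal.span {Lm m} ≤
        Ideal.span {algebraMap S (S' m) L} ⊔ ((I.map φ).map (algebraMap S (S' m))) ^ m) :
    J.map φ ≤ Ideal.span {L} := by
  refine (Ideal.map_mono hJ).trans ?_
  rw [← CongruenceLimit.iInf_sup_pow_eq_self (I.map φ) (Ideal.span {L}) hI]
  refine le_iInf fun m ↦ ?_
  rcases Nat.eq_zero_or_pos m with rfl | hm
  · rw [pow_zero, Ideal.one_eq_top, sup_top_eq]; exact le_top
  · exact le_sup_left.trans (sup_le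
      (map_span_mul_fittingIdeal_le_sup_of_congruence_descent_le_defect φ I a d n (R' m) (S' m) (φ' m) (hφ' m)
        (N m) (βM m) (hβM m hm) (ι m) (βN m) (hex m hm) (hβN m hm) (hgen m hm) (hd m hm) (hF m hm) (hc m hm))
      le_sup_right)

end CongruenceDescent

/-! ### §2 On `X^Σ = X_ac^Σ(E[p^∞])`: the twisted member limit with bounded defect, printed member shape -/

section XAc

variable {K : Type} [Field K] [NumberField K] (E : WeierstrassCurve K) [E.IsElliptic]
  (p : ℕ) [Fact p.Prime] (κ : ZpExtension K p) (𝔭 : HeightOneSpectrum (𝓞 K))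
  {S : Set (HeightOneSpectrum (𝓞 K))} (γ : Field.absoluteGaloisGroup K) [Fact (κ.IsTopGenerator γ)]

universe v w

/-- **The member limit ON `X^Σ` at the Fitting level, PRINTED rational member shape, congruences WITH BOUNDED DEFECT.** As g11's
`…_descent_le_printed` (p612782) except that, for each `m ≥ 1`, the member congruence is the defect correspondence
`(R′_m ⊗_Λ X^Σ)/p^m ↠ Q_m ↞ N_m/p^m ← Kd_m` with `Kd_m` generated by `n` elements and killed by `d ∈ Λ` (`n`, `d` UNIFORM in `m`).
THEN `((a·d^n)·Fitt₀_Λ(X^Σ))·R₀⟦T⟧ ⊆ (L^Σ)`. Pure algebra; CONDITIONAL on the displayed inputs.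
[cite: Castella2018Erratum, Lemma 2.1, (2.5) and proof of Thm. 1.1 (p. 4)] [cite: StacksProject, Tag 07ZA (2), (3), (4)] -/
theorem AcSelmer.XAc.map_span_mul_fittingIdeal_le_span_of_oneSided_congruences_descent_le_printed_defect
    (hS : S.Finite) (a d : IwasawaAlgebra p) (n : ℕ) (LS : UnrSeries p) (R' : ℕ → Type v) [∀ m, CommRing (R' m)]
    [∀ m, IsNoetherianRing (R' m)] [∀ m, IsDomain (R' m)] [∀ m, UniqueFactorizationMonoid (R' m)]
    [∀ m, Algebra (IwasawaAlgebra p) (R' m)]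
    (S' : ℕ → Type w) [∀ m, CommRing (S' m)] [∀ m, Algebra (UnrSeries p) (S' m)]
    [∀ m, Module.FaithfullyFlat (UnrSeries p) (S' m)] (φ' : ∀ m, R' m →+* S' m)
    (hφ' : ∀ m, (φ' m).comp (algebraMap (IwasawaAlgebra p) (R' m)) =
      (algebraMap (UnrSeries p) (S' m)).comp (PowerSeries.map (toUnr p)))
    (N : ℕ → Type) [∀ m, AddCommGroup (N m)] [∀ m, Module (R' m) (N m)]
    [∀ m, Module.Finite (R' m) (N m)]
    (Q : ℕ → Type) [∀ m, AddCommGroup (Q m)] [∀ m, Module (R' m) (Q m)] [∀ m, Module.Finite (R' m) (Q m)]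
    (Kd : ℕ → Type) [∀ m, AddCommGroup (Kd m)] [∀ m, Module (R' m) (Kd m)]
    (Lm : ∀ m, S' m)
    (βM : ∀ m, (((R' m ⊗[IwasawaAlgebra p] XAc E p κ 𝔭 S γ) ⧸
        (((Ideal.span {(PowerSeries.C (p : ℤ_[p]) : IwasawaAlgebra p)}).map
            (algebraMap (IwasawaAlgebra p) (R' m))) ^ m •
          (⊤ : Submodule (R' m) (R' m ⊗[IwasawaAlgebra p] XAc E p κ 𝔭 S γ)))) →ₗ[R' m] Q m))
    (hβM : ∀ m, 1 ≤ m → Function.Surjective (βM m))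
    (ι : ∀ m, Kd m →ₗ[R' m] (N m ⧸ (((Ideal.span {(PowerSeries.C (p : ℤ_[p]) : IwasawaAlgebra p)}).map
        (algebraMap (IwasawaAlgebra p) (R' m))) ^ m • (⊤ : Submodule (R' m) (N m)))))
    (βN : ∀ m, (N m ⧸ (((Ideal.span {(PowerSeries.C (p : ℤ_[p]) : IwasawaAlgebra p)}).map
        (algebraMap (IwasawaAlgebra p) (R' m))) ^ m • (⊤ : Submodule (R' m) (N m)))) →ₗ[R' m] Q m)
    (hex : ∀ m, 1 ≤ m → Function.Exact (ι m) (βN m)) (hβN : ∀ m, 1 ≤ m → Function.Surjective (βN m))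
    (hgen : ∀ m, 1 ≤ m → ∃ g : Fin n → Kd m, Submodule.span (R' m) (Set.range g) = ⊤)
    (hd : ∀ m, 1 ≤ m → algebraMap (IwasawaAlgebra p) (R' m) d ∈ Module.annihilator (R' m) (Kd m))
    (hCh : ∀ m : ℕ, 1 ≤ m → Module.IsTorsion (R' m) (N m) →
      (Ideal.span {algebraMap (IwasawaAlgebra p) (R' m) a} * Module.charIdeal (R' m) (N m)).map (φ' m) ≤
        Ideal.span {Lm m})
    (hc : ∀ m : ℕ, 1 ≤ m →
      Ideal.span {Lm m} ≤
        Ideal.span {algebraMap (UnrSeries p) (S' m) LS} ⊔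
          (((Ideal.span {(PowerSeries.C (p : ℤ_[p]) : IwasawaAlgebra p)}).map
              (PowerSeries.map (toUnr p))).map (algebraMap (UnrSeries p) (S' m))) ^ m) :
    (Ideal.span {a * d ^ n} * Module.fittingIdeal (IwasawaAlgebra p) (XAc E p κ 𝔭 S γ) 0).map
        (PowerSeries.map (toUnr p)) ≤ Ideal.span {LS} := by
  haveI : Module.Finite (IwasawaAlgebra p) (XAc E p κ 𝔭 S γ) := XAc.module_finite κ 𝔭 S γ hS
  haveI := HidaLimitAlgebra.isNoetherianRing_unrSeries (p := p)
  have hI : (Ideal.span {(PowerSeries.C (p : ℤ_[p]) : IwasawaAlgebra p)}).map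
      (PowerSeries.map (toUnr p)) ≤ (⊥ : Ideal (UnrSeries p)).jacobson := by
    rw [HidaLimitAlgebra.map_span_C_p]
    exact HidaLimitAlgebra.span_C_p_le_jacobson_unrSeries
  exact CongruenceDescent.map_le_span_of_oneSided_congruences_descent_le_of_le_span_mul_defect
    (PowerSeries.map (toUnr p)) (Ideal.span {(PowerSeries.C (p : ℤ_[p]) : IwasawaAlgebra p)}) hI a d n
    (le_refl _) LS R' S' φ' hφ' N Q Kd Lm βM hβM ι βN hex hβN hgen hd
    (fun m hm ↦ CongruenceDescent.map_span_mul_fittingIdeal_le_of_printed_charIdeal_le (φ' m)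
      (algebraMap (IwasawaAlgebra p) (R' m) a) (hCh m hm)) hc

/-! ### §3 The `∃ k`-clause of ♭B_T from the defect key: g11's twisted recombination with `e ↦ e + kn` -/

/-- **From the defect key to ♭B_T's clause.** With `a = C(p)^e` and `d = C(p)^k`, §2's conclusion is g11's twisted key with exponent
`e + k·n` (`C(p)^e · (C(p)^k)^n = C(p)^{e+kn}`), so g11's UNCHANGED recombination
`AcSelmer.XAc.forall_C_pow_mul_mem_span_of_map_span_mul_fittingIdeal_le` yields: every `G ∈ Ch_Λ(X^∅)·R₀⟦T⟧` satisfies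
`C(p^{e+kn})·G ∈ (L)` — ♭B_T's `∃ k`-clause with `k := e + kn`. [cite: Castella2018Erratum, proof of Thm. 1.1 (p. 4), read one-sidedly] -/
theorem AcSelmer.XAc.forall_C_pow_mul_mem_span_of_defect_key (hS : S.Finite)
    (hT : Module.IsTorsion (IwasawaAlgebra p) (XAc E p κ 𝔭 S γ)) (e k n : ℕ) {LS : UnrSeries p}
    (key : (Ideal.span {(PowerSeries.C (p : ℤ_[p]) : IwasawaAlgebra p) ^ e *
        ((PowerSeries.C (p : ℤ_[p]) : IwasawaAlgebra p) ^ k) ^ n} *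
        Module.fittingIdeal (IwasawaAlgebra p) (XAc E p κ 𝔭 S γ) 0).map (PowerSeries.map (toUnr p)) ≤
      Ideal.span {LS})
    {PS : IwasawaAlgebra p} (hPS : PS ≠ 0)
    (hX : XAc.charIdeal E p κ 𝔭 ∅ γ * Ideal.span {PS} ≤ XAc.charIdeal E p κ 𝔭 S γ)
    {L : UnrSeries p} (hLS : L * PowerSeries.map (toUnr p) PS ∣ LS) :
    ∀ G ∈ (XAc.charIdeal E p κ 𝔭 ∅ γ).map (PowerSeries.map (toUnr p)),
      PowerSeries.C (((p : ℕ) : unrIntegers p) ^ (e + k * n)) * G ∈ Ideal.span {L} := by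
  refine AcSelmer.XAc.forall_C_pow_mul_mem_span_of_map_span_mul_fittingIdeal_le E p κ 𝔭 γ hS hT (e + k * n) ?_ hPS
    hX hLS
  have hpow : (PowerSeries.C (p : ℤ_[p]) : IwasawaAlgebra p) ^ (e + k * n) =
      (PowerSeries.C (p : ℤ_[p]) : IwasawaAlgebra p) ^ e * ((PowerSeries.C (p : ℤ_[p]) : IwasawaAlgebra p) ^ k) ^ n := by
    rw [pow_add, pow_mul]
  rw [hpow]
  exact key

end XAc

end Summit.BirchSwinnertonDyer.Rank1Residual.X11b

end
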